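import Mathlib
import HarnessLib
import Summits.HubbardSuperconductivity.HubbardSuperconductivity.Theorems.KLProgrammeKLRegimeEngineV8DefsG2
import Summits.HubbardSuperconductivity.HubbardSuperconductivity.Theorems.KLProgrammeKLRegimeSplitGeoRaise
import Summits.HubbardSuperconductivity.HubbardSuperconductivity.Theorems.KLProgrammeKLRegimeEngineE4ConstDefs

/-!
# K3 engine package, `G`-level v4: `klEngGeo4 := klEngGeo3.raise (klIsoT ^ 4) klE4T`

Cell `gate-hubbard-kl`, seat p3 g6 (DefsG4 author, plan g13 (R7)(b)/(R9)(a), CASE S of l.1956).  The ONE batched `G`-level swap of the ENGINE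
child `KLRegimeEngineV14` (stmt-HubbardSuperconductivity-19918): the freezing constant absorbs the fourth power of the isotropic torus constant
`klIsoT` (`…EngineIsoTorusDefs`; the (E5-S)₀ closer needs `klIsoT ^ 4 ≤ G.CF`) and the first-moment constant absorbs the (E4)₀ constant
`klE4T` (`…EngineE4ConstDefs`; k3c2-p1 g3's rider «cE4 = 2^10 does not suffice», STATUS 05:02Z: his closer needs `klE4T ≤ G.cE4`), every other
field of `klEngGeo3` untouched.  Both new constants are closed terms fixed NOW (classical `if`-witnesses of the named statements
`IsoTorusBoundAt` / `E4ScaleZeroAt`), so this is the ONE `G`-level swap: it waits neither on (J3) nor on the (E4)₀ size layer.  Via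
`GeoConsts.raise` (p497126):

* `klEngGeo4`, **`klEngGeo4_wf`**, `klEngGeo4_eq_raise` (`rfl`), `klEngGeo4_CF`, `klIsoT_pow_four_le_klEngGeo4_CF`, `klEngGeo3_CF_le_klEngGeo4_CF`,
  `klEngGeo4_cE4`, `klE4T_le_klEngGeo4_cE4`, `klEngGeo3_cE4_le_klEngGeo4_cE4`, and `rfl` lemmas for the fields other lanes read numerically (`bhi`, `ppGain`, `phGain`, `S`, `SL`, `Bf`,
  `aplus`, `ζ`, `cloc`, `θ`, `a`, `atop`, `abot`);
* **`engineBoundsAtV9S_klEngGeo4_of_klEngGeo3`** — the V9 engine slot proved at `klEngGeo3` transfers to `klEngGeo4` (`0 ≤ P.Klam`); the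
  history / two-leg slot do NOT transfer by monotonicity (ruling (R9)(b): step closers are typed `G`-parametrically).

The registrant's re-registration is the token swap `klEngGeo3 ↦ klEngGeo4` + this import (pre-render sha16 6b29589f007f9094).
-/

namespace Summit.HubbardSuperconductivity.HubbardSuperconductivity.Theorems.EngineV8

noncomputable section

open Real Finset Literature.MathematicalPhysics.QuantumLattice Literature.Probability.LatticeModels
open Summit.HubbardSuperconductivity.HubbardSuperconductivity.Theorems.KLRegimeSplit

/-- **`klEngGeo4` — the engine's absolute constants `G`, v4**: `klEngGeo3` with `CF := max klEngGeo3.CF (klIsoT ^ 4)` and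
`cE4 := max klEngGeo3.cE4 klE4T`, via `GeoConsts.raise`. -/
def klEngGeo4 : GeoConsts := klEngGeo3.raise (klIsoT ^ 4) klE4T

/-- `klEngGeo4 = klEngGeo3.raise (klIsoT ^ 4) klE4T` (`rfl`; the form the `_raise` transfer lemmas of `…SplitGeoRaise` consume). -/
theorem klEngGeo4_eq_raise : klEngGeo4 = klEngGeo3.raise (klIsoT ^ 4) klE4T := rfl

/-- **`klEngGeo4` is well formed.** -/
theorem klEngGeo4_wf : klEngGeo4.WF := GeoConsts.raise_wf klEngGeo3_wf _ _

/-- `klEngGeo4.CF = max klEngGeo3.CF (klIsoT ^ 4)`. -/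
theorem klEngGeo4_CF : klEngGeo4.CF = max klEngGeo3.CF (klIsoT ^ 4) := rfl

/-- **`klIsoT ^ 4 ≤ klEngGeo4.CF`** — the `hCF` input of the (E5-S)₀ closer at the v4 package. -/
theorem klIsoT_pow_four_le_klEngGeo4_CF : klIsoT ^ 4 ≤ klEngGeo4.CF := le_max_right _ _

/-- `klEngGeo3.CF ≤ klEngGeo4.CF`. -/
theorem klEngGeo3_CF_le_klEngGeo4_CF : klEngGeo3.CF ≤ klEngGeo4.CF := le_max_left _ _

/-- `2 ^ 52 ≤ klEngGeo4.CF`. -/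
theorem two_pow_le_klEngGeo4_CF : (2 : ℝ) ^ 52 ≤ klEngGeo4.CF := klEngGeo3_CF ▸ klEngGeo3_CF_le_klEngGeo4_CF

/-- `klEngGeo4.cE4 = max klEngGeo3.cE4 klE4T`. -/
theorem klEngGeo4_cE4 : klEngGeo4.cE4 = max klEngGeo3.cE4 klE4T := rfl

/-- **`klE4T ≤ klEngGeo4.cE4`** — the `hcE4` input of the (E4)₀ consumer form at the v4 package. -/
theorem klE4T_le_klEngGeo4_cE4 : klE4T ≤ klEngGeo4.cE4 := le_max_right _ _

/-- `klEngGeo3.cE4 ≤ klEngGeo4.cE4`. -/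
theorem klEngGeo3_cE4_le_klEngGeo4_cE4 : klEngGeo3.cE4 ≤ klEngGeo4.cE4 := le_max_left _ _

/-- untouched field `bhi`. -/
theorem klEngGeo4_bhi : klEngGeo4.bhi = klEngGeo3.bhi := rfl
/-- untouched field `ppGain`. -/
theorem klEngGeo4_ppGain : klEngGeo4.ppGain = klEngGeo3.ppGain := rfl
/-- untouched field `phGain`. -/
theorem klEngGeo4_phGain : klEngGeo4.phGain = klEngGeo3.phGain := rfl
/-- untouched field `S`. -/
theorem klEngGeo4_S : klEngGeo4.S = klEngGeo3.S := rfl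
/-- untouched field `SL`. -/
theorem klEngGeo4_SL : klEngGeo4.SL = klEngGeo3.SL := rfl
/-- untouched field `Bf`. -/
theorem klEngGeo4_Bf : klEngGeo4.Bf = klEngGeo3.Bf := rfl
/-- untouched field `aplus`. -/
theorem klEngGeo4_aplus : klEngGeo4.aplus = klEngGeo3.aplus := rfl
/-- untouched field `ζ`. -/
theorem klEngGeo4_ζ : klEngGeo4.ζ = klEngGeo3.ζ := rfl
/-- untouched field `Z`. -/
theorem klEngGeo4_Z : klEngGeo4.Z = klEngGeo3.Z := rfl
/-- untouched field `cloc`. -/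
theorem klEngGeo4_cloc : klEngGeo4.cloc = klEngGeo3.cloc := rfl
/-- untouched field `θ`. -/
theorem klEngGeo4_θ : klEngGeo4.θ = klEngGeo3.θ := rfl
/-- untouched field `a`. -/
theorem klEngGeo4_a : klEngGeo4.a = klEngGeo3.a := rfl
/-- untouched field `atop`. -/
theorem klEngGeo4_atop : klEngGeo4.atop = klEngGeo3.atop := rfl
/-- untouched field `abot`. -/
theorem klEngGeo4_abot : klEngGeo4.abot = klEngGeo3.abot := rfl
/-- untouched field `blo`. -/
theorem klEngGeo4_blo : klEngGeo4.blo = klEngGeo3.blo := rfl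

/-- **The V9 engine slot transfers from `klEngGeo3` to `klEngGeo4`** (`0 ≤ P.Klam`): every clause proved at the v3 package holds at v4. -/
theorem engineBoundsAtV9S_klEngGeo4_of_klEngGeo3 {L M : ℕ} [NeZero L] [NeZero M] {P : SplitConsts} {Q : EngConsts} {β U μ : ℝ}
    {K : TrigPolyC4v} {n : ℕ} (hK : 0 ≤ P.Klam) (h : EngineBoundsAtV9S L M klEngGeo3 P Q β U μ K n) :
    EngineBoundsAtV9S L M klEngGeo4 P Q β U μ K n :=
  engineBoundsAtV9S_raise_of _ _ hK h

/-- `IsoTupleL1AtS` transfers from `klEngGeo3` to `klEngGeo4`. -/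
theorem isoTupleL1AtS_klEngGeo4_of_klEngGeo3 {L M : ℕ} [NeZero L] [NeZero M] {P : SplitConsts} {β U μ : ℝ} {K : TrigPolyC4v} {n : ℕ}
    (h : IsoTupleL1AtS L M klEngGeo3 P β U μ K n) : IsoTupleL1AtS L M klEngGeo4 P β U μ K n :=
  isoTupleL1AtS_raise_of _ _ h

/-- `EngineFirstMoments` transfers from `klEngGeo3` to `klEngGeo4` (`0 ≤ P.Klam`). -/
theorem engineFirstMoments_klEngGeo4_of_klEngGeo3 {L M : ℕ} [NeZero L] [NeZero M] {P : SplitConsts} {Q : EngConsts} {β U μ : ℝ}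
    {K : TrigPolyC4v} {n : ℕ} (hK : 0 ≤ P.Klam) (h : EngineFirstMoments L M klEngGeo3 P Q β U μ K n) :
    EngineFirstMoments L M klEngGeo4 P Q β U μ K n :=
  engineFirstMoments_raise_of _ _ hK h

end

end Summit.HubbardSuperconductivity.HubbardSuperconductivity.Theorems.EngineV8
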